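import Mathlib
import Literature.NumberTheory.Transcendental.PreBlochGroup
import Literature.NumberTheory.Transcendental.BlochWignerDilogarithm
import Literature.NumberTheory.Transcendental.BlochWignerFiveTerm
import Literature.NumberTheory.Transcendental.BlochGroupRegulator
import HarnessLib

/-!
# The Dehn pairings and the regulator components descend to the pre-Bloch group `P(F)`

Companion of `BlochGroupRegulator.lean` (the named fact
`Borel1977_blochGroup_regulator_kernel_torsion`, Neumann 1998, Thm. 3.2 [Neumann1998]).
Everything here is PROVED; the three definitions are an auxiliary extension-by-zero of a
character and the two descended maps.

Neumann's complex Dehn invariant `δ : P(k) → kˣ ∧ kˣ`, `[z] ↦ (1 - z) ∧ z` (Prop./Def. 2.5) and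
the Borel regulator `B(k) → ℝ^{r₂}` of Thm. 3.2 ("induced on generators of `P(k)` by
`[z] ↦ (vol[σ₁(z)], …, vol[σ_{r₂}(z)])`") are maps on the PRE-BLOCH GROUP
`P(k) = ℤ⟨k ∖ {0,1}⟩/(five-term relations (2.3))`. The fact file transcribes them only on the
free abelian group `ℤ⟨F ∖ {0,1}⟩` (`PreBloch.wedgePairing u v`, `PreBloch.regulatorAt σ`). Here we
check that both kill the five-term relators of `PreBlochGroup.lean`, hence descend to `P(F)`:

* `PreBloch.wedgePairing_fiveTermRelator` — the rational shadow of the classical computation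
  `δ(five-term relation) = 0` behind Prop./Def. 2.5 (characters `Fˣ → ℚ` kill `-1`, so none of
  the `2`-torsion bookkeeping of `kˣ ∧ kˣ` arises); the descended map `PreBloch.dehnPairing u v :
  P(F) →+ ℚ`.
* `blochWignerDilog_five_term_neumann` — the five-term functional equation of `D₂` in Neumann's
  variables (2.3), `D(x) - D(y) + D(y/x) - D((1-x⁻¹)/(1-y⁻¹)) + D((1-x)/(1-y)) = 0` (§2.1: "`D₂`
  satisfies a functional equation corresponding to the five-term relation"), from Zagier's
  symmetric form `blochWignerDilog_five_term` (`BlochWignerFiveTerm.lean`) at `(x, y⁻¹)` and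
  `D(z⁻¹) = D(1 - z) = -D(z)`; hence `PreBloch.regulatorAt_fiveTermRelator` and the descended map
  `PreBloch.regulator σ : P(F) →+ ℝ`, `[z] ↦ D(σ z)`.
* `Borel1977_blochGroup_regulator_kernel_torsion.of_preBloch` — the fact restated, equivalently,
  for elements of `P(F)`: killed by all Dehn pairings and all regulator components ⇒ torsion.

Nothing here proves the fact itself (Borel's theorem); see the fact file for what it rests on.

## References

* W. D. Neumann, *Hilbert's 3rd problem and invariants of 3-manifolds*, Geom. Topol. Monogr. 1
  (1998) 383–411, arXiv:math/9712226: eq. (2.3), Prop./Def. 2.5, §2.1, Thm. 3.2. [Neumann1998]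
* D. Zagier, *The dilogarithm function* (2007), Ch. I §3 (five-term relation of `D`).
  [Zagier2007Dilogarithm]
-/

noncomputable section

namespace Literature.NumberTheory.Transcendental

namespace PreBloch

variable {F : Type*} [Field F]

open Classical in
/-- An additive character `u : Fˣ → ℚ` extended by `0` to all of `F` (a "`u ∘ log`":
`logChar u (a * b) = logChar u a + logChar u b` for `a, b ≠ 0`, and `logChar u (-a) = logChar u a`
because `ℚ` has no `2`-torsion). The value at `0` is a junk value, never used. [folklore] -/
def logChar (u : Additive Fˣ →+ ℚ) (a : F) : ℚ :=
  if h : a = 0 then 0 else u (Additive.ofMul (Units.mk0 a h))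

variable (u v : Additive Fˣ →+ ℚ)

/-- `logChar` at a nonzero element is the character at the corresponding unit. [folklore] -/
theorem logChar_of_ne_zero {a : F} (h : a ≠ 0) :
    logChar u a = u (Additive.ofMul (Units.mk0 a h)) := by
  simp [logChar, h]

/-- The junk value `logChar u 0 = 0`. [folklore] -/
@[simp] theorem logChar_zero : logChar u (0 : F) = 0 := by
  simp [logChar]

/-- `logChar u 1 = 0`. [folklore] -/
@[simp] theorem logChar_one : logChar u (1 : F) = 0 := by
  rw [logChar_of_ne_zero u one_ne_zero, Units.mk0_one, ofMul_one, map_zero]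

/-- `logChar u (a * b) = logChar u a + logChar u b` for `a, b ≠ 0`. [folklore] -/
theorem logChar_mul {a b : F} (ha : a ≠ 0) (hb : b ≠ 0) :
    logChar u (a * b) = logChar u a + logChar u b := by
  rw [logChar_of_ne_zero u (mul_ne_zero ha hb), logChar_of_ne_zero u ha, logChar_of_ne_zero u hb,
    ← map_add, ← ofMul_mul]
  congr 2
  exact Units.ext (by simp)

/-- `logChar u a⁻¹ = -logChar u a`. [folklore] -/
theorem logChar_inv (a : F) : logChar u a⁻¹ = -logChar u a := by
  rcases eq_or_ne a 0 with rfl | ha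
  · simp
  · rw [logChar_of_ne_zero u (inv_ne_zero ha), logChar_of_ne_zero u ha, ← map_neg, ← ofMul_inv]
    congr 2
    exact Units.ext (by simp)

/-- `logChar u (a / b) = logChar u a - logChar u b` for `a, b ≠ 0`. [folklore] -/
theorem logChar_div {a b : F} (ha : a ≠ 0) (hb : b ≠ 0) :
    logChar u (a / b) = logChar u a - logChar u b := by
  rw [div_eq_mul_inv, logChar_mul u ha (inv_ne_zero hb), logChar_inv, sub_eq_add_neg]

/-- `logChar u (-1) = 0`: `2 • u(-1) = u(1) = 0` in the torsion-free group `ℚ`. [folklore] -/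
theorem logChar_neg_one : logChar u (-1 : F) = 0 := by
  have h2 : logChar u ((-1 : F) * (-1)) = logChar u (-1) + logChar u (-1) :=
    logChar_mul u (neg_ne_zero.2 one_ne_zero) (neg_ne_zero.2 one_ne_zero)
  rw [neg_one_mul, neg_neg, logChar_one] at h2
  linarith

/-- `logChar u (-a) = logChar u a`. [folklore] -/
theorem logChar_neg (a : F) : logChar u (-a) = logChar u a := by
  rcases eq_or_ne a 0 with rfl | ha
  · simp
  · rw [← neg_one_mul, logChar_mul u (neg_ne_zero.2 one_ne_zero) ha, logChar_neg_one, zero_add]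

/-- The character at the unit `z` of a generator `z ∈ F ∖ {0,1}`. [folklore] -/
theorem apply_unit (g : Gen F) : u (Additive.ofMul g.unit) = logChar u g.val :=
  (logChar_of_ne_zero u g.val_ne_zero).symm

/-- The character at the unit `1 - z` of a generator `z ∈ F ∖ {0,1}`. [folklore] -/
theorem apply_unitOneSub (g : Gen F) :
    u (Additive.ofMul g.unitOneSub) = logChar u (1 - g.val) :=
  (logChar_of_ne_zero u (sub_ne_zero.2 g.val_ne_one.symm)).symm

/-- The pairing on a generator in terms of `logChar`:
`⟨u ∧ v, (1 - z) ∧ z⟩ = u(1 - z)·v(z) - v(1 - z)·u(z)`. [cite: Neumann1998, Prop. 2.5] -/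
theorem wedgePairing_of_eq_logChar (g : Gen F) :
    wedgePairing u v (FreeAbelianGroup.of g) =
      logChar u (1 - g.val) * logChar v g.val - logChar v (1 - g.val) * logChar u g.val := by
  rw [wedgePairing_of, apply_unit, apply_unit, apply_unitOneSub, apply_unitOneSub]

/-- Values of a character on the last three terms `y/x`, `(1 - x⁻¹)/(1 - y⁻¹)`, `(1 - x)/(1 - y)`
of the five-term relator (2.3) and on `1 - (each of them)`, in the atoms
`x, y, 1 - x, 1 - y, x - y`. [cite: Neumann1998, eq. (2.3)] -/
theorem logChar_fiveTerm (w : Additive Fˣ →+ ℚ) {a b : F} (ha0 : a ≠ 0) (ha1 : a ≠ 1)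
    (hb0 : b ≠ 0) (hb1 : b ≠ 1) (hab : a ≠ b) :
    logChar w (b / a) = logChar w b - logChar w a ∧
    logChar w (1 - b / a) = logChar w (a - b) - logChar w a ∧
    logChar w ((1 - a⁻¹) / (1 - b⁻¹)) =
      logChar w (1 - a) - logChar w a - (logChar w (1 - b) - logChar w b) ∧
    logChar w (1 - (1 - a⁻¹) / (1 - b⁻¹)) = logChar w (a - b) - logChar w a - logChar w (1 - b) ∧
    logChar w ((1 - a) / (1 - b)) = logChar w (1 - a) - logChar w (1 - b) ∧
    logChar w (1 - (1 - a) / (1 - b)) = logChar w (a - b) - logChar w (1 - b) := by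
  have ha1' : (1 : F) - a ≠ 0 := sub_ne_zero.2 (Ne.symm ha1)
  have hb1' : (1 : F) - b ≠ 0 := sub_ne_zero.2 (Ne.symm hb1)
  have hb1'' : b - 1 ≠ 0 := sub_ne_zero.2 hb1
  have hab' : a - b ≠ 0 := sub_ne_zero.2 hab
  refine ⟨logChar_div w hb0 ha0, ?_, ?_, ?_, logChar_div w ha1' hb1', ?_⟩
  · rw [show 1 - b / a = (a - b) / a by field_simp, logChar_div w hab' ha0]
  · rw [show (1 - a⁻¹) / (1 - b⁻¹) = (1 - a) * b / (a * (1 - b)) by field_simp; ring,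
      logChar_div w (mul_ne_zero ha1' hb0) (mul_ne_zero ha0 hb1'), logChar_mul w ha1' hb0,
      logChar_mul w ha0 hb1']
    ring
  · rw [show 1 - (1 - a⁻¹) / (1 - b⁻¹) = (a - b) / (a * (1 - b)) by field_simp; ring,
      logChar_div w hab' (mul_ne_zero ha0 hb1'), logChar_mul w ha0 hb1']
    ring
  · rw [show 1 - (1 - a) / (1 - b) = (a - b) / (1 - b) by field_simp; ring, logChar_div w hab' hb1']

/-- **The Dehn invariant kills the five-term relation** (rationally): every pairing
`wedgePairing u v` vanishes on the five-term relators (2.3) — the computation behind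
Prop./Def. 2.5 (`δ` is defined on `P(ℂ)`). [cite: Neumann1998, Prop. 2.5] -/
theorem wedgePairing_fiveTermRelator (x y : Gen F) (hxy : x.val ≠ y.val) :
    wedgePairing u v (fiveTermRelator F x y hxy) = 0 := by
  obtain ⟨u3, u3', u4, u4', u5, u5'⟩ :=
    logChar_fiveTerm u x.val_ne_zero x.val_ne_one y.val_ne_zero y.val_ne_one hxy
  obtain ⟨v3, v3', v4, v4', v5, v5'⟩ :=
    logChar_fiveTerm v x.val_ne_zero x.val_ne_one y.val_ne_zero y.val_ne_one hxy
  simp only [fiveTermRelator, map_add, map_sub, wedgePairing_of_eq_logChar, Gen.val_quot,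
    Gen.val_quotInv, Gen.val_quotSub]
  rw [u3, u3', u4, u4', u5, u5', v3, v3', v4, v4', v5, v5']
  ring

/-- The five-term relators lie in the kernel of every pairing. [cite: Neumann1998, Prop. 2.5] -/
theorem closure_fiveTermRelators_le_ker_wedgePairing :
    AddSubgroup.closure (fiveTermRelators F) ≤ (wedgePairing u v).ker :=
  (AddSubgroup.closure_le _).2 (by
    rintro r ⟨x, y, hxy, rfl⟩
    simp only [SetLike.mem_coe, AddMonoidHom.mem_ker]
    exact wedgePairing_fiveTermRelator u v x y hxy)

/-- Hence every pairing vanishes on the subgroup generated by the five-term relators.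
[cite: Neumann1998, Prop. 2.5] -/
theorem wedgePairing_eq_zero_of_mem_closure {ξ : FreeAbelianGroup (Gen F)}
    (hξ : ξ ∈ AddSubgroup.closure (fiveTermRelators F)) : wedgePairing u v ξ = 0 :=
  (AddMonoidHom.mem_ker).1 (closure_fiveTermRelators_le_ker_wedgePairing u v hξ)

/-- **The Dehn pairing on `P(F)`**: the descent of `wedgePairing u v` to the pre-Bloch group — the
`(u ∧ v)`-component, rationally, of Neumann's complex Dehn invariant
`δ : P(k) → kˣ ∧ kˣ`, `[z] ↦ (1 - z) ∧ z`. [cite: Neumann1998, Prop. 2.5] -/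
def dehnPairing : PreBloch F →+ ℚ :=
  QuotientAddGroup.lift (AddSubgroup.closure (fiveTermRelators F)) (wedgePairing u v)
    (closure_fiveTermRelators_le_ker_wedgePairing u v)

/-- The Dehn pairing of the class of `ξ ∈ ℤ⟨F ∖ {0,1}⟩`. [cite: Neumann1998, Prop. 2.5] -/
@[simp] theorem dehnPairing_proj (ξ : FreeAbelianGroup (Gen F)) :
    dehnPairing u v (proj ξ) = wedgePairing u v ξ :=
  rfl

/-- The Dehn pairing of a generator `[z]`. [cite: Neumann1998, Prop. 2.5] -/
theorem dehnPairing_mk (z : F) (hz : z ≠ 0 ∧ z ≠ 1) :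
    dehnPairing u v (PreBloch.mk z hz) =
      logChar u (1 - z) * logChar v z - logChar v (1 - z) * logChar u z :=
  wedgePairing_of_eq_logChar u v ⟨z, hz⟩

end PreBloch

/-- **The five-term relation of `D` in Neumann's variables** (eq. (2.3); §2.1, "`D₂` satisfies a
functional equation corresponding to the five-term relation"): for `x ≠ y` in `ℂ ∖ {0, 1}`,
`D(x) - D(y) + D(y/x) - D((1 - x⁻¹)/(1 - y⁻¹)) + D((1 - x)/(1 - y)) = 0`. Derived from Zagier's
symmetric form `blochWignerDilog_five_term` at `(x, y⁻¹)` with `D(z⁻¹) = D(1 - z) = -D(z)`.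
[cite: Neumann1998, §2.1] -/
theorem blochWignerDilog_five_term_neumann {x y : ℂ} (hx0 : x ≠ 0) (hx1 : x ≠ 1) (hy0 : y ≠ 0)
    (hy1 : y ≠ 1) (hxy : x ≠ y) :
    blochWignerDilog x - blochWignerDilog y + blochWignerDilog (y / x) -
        blochWignerDilog ((1 - x⁻¹) / (1 - y⁻¹)) + blochWignerDilog ((1 - x) / (1 - y)) = 0 := by
  have hy0' : y⁻¹ ≠ 0 := inv_ne_zero hy0
  have hy1' : y⁻¹ ≠ 1 := fun h => hy1 (inv_eq_one.1 h)
  have hxy' : x * y⁻¹ ≠ 1 := fun h => hxy (by rwa [mul_inv_eq_one₀ hy0] at h)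
  have hZ := blochWignerDilog_five_term hx0 hx1 hy0' hy1' hxy'
  have hx1' : (1 : ℂ) - x ≠ 0 := sub_ne_zero.2 (Ne.symm hx1)
  have hy1'' : (1 : ℂ) - y ≠ 0 := sub_ne_zero.2 (Ne.symm hy1)
  have hy1''' : y - 1 ≠ 0 := sub_ne_zero.2 hy1
  have hxy'' : x - y ≠ 0 := sub_ne_zero.2 hxy
  have hyx : y - x ≠ 0 := sub_ne_zero.2 (Ne.symm hxy)
  -- the four non-trivial arguments of Zagier's form at `(x, y⁻¹)`, in Neumann's terms
  have e2 : blochWignerDilog y⁻¹ = -blochWignerDilog y := blochWignerDilog_inv y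
  have e3 : blochWignerDilog (1 - x * y⁻¹) = blochWignerDilog (y / x) := by
    rw [blochWignerDilog_one_sub, ← blochWignerDilog_inv, mul_inv, inv_inv, ← div_eq_inv_mul]
  have h1v : 1 - (1 - x⁻¹) / (1 - y⁻¹) = (y - x) / (x * (y - 1)) := by
    field_simp
    ring
  have harg : (1 - x) / (1 - x * y⁻¹) = 1 - ((y - x) / (x * (y - 1)))⁻¹ := by
    rw [inv_div]
    field_simp
    ring
  have e4 : blochWignerDilog ((1 - x) / (1 - x * y⁻¹)) =
      -blochWignerDilog ((1 - x⁻¹) / (1 - y⁻¹)) := by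
    rw [harg, blochWignerDilog_one_sub, ← h1v, blochWignerDilog_inv, blochWignerDilog_one_sub,
      neg_neg]
  have h1w : 1 - (1 - x) / (1 - y) = (x - y) / (1 - y) := by
    field_simp
    ring
  have harg' : (1 - y⁻¹) / (1 - x * y⁻¹) = ((x - y) / (1 - y))⁻¹ := by
    rw [inv_div]
    field_simp
    ring
  have e5 : blochWignerDilog ((1 - y⁻¹) / (1 - x * y⁻¹)) = blochWignerDilog ((1 - x) / (1 - y)) := by
    rw [harg', ← h1w, blochWignerDilog_inv, blochWignerDilog_one_sub, neg_neg]
  rw [e2, e3, e4, e5] at hZ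
  linarith

namespace PreBloch

variable {F : Type*} [Field F]

/-- **The regulator kills the five-term relation**: each component `[z] ↦ D(σ z)` vanishes on the
five-term relators (2.3) (the five-term functional equation of `D₂`, §2.1).
[cite: Neumann1998, Thm. 3.2] -/
theorem regulatorAt_fiveTermRelator (σ : F →+* ℂ) (x y : Gen F) (hxy : x.val ≠ y.val) :
    regulatorAt σ (fiveTermRelator F x y hxy) = 0 := by
  have hx0 : σ x.val ≠ 0 := (map_ne_zero σ).2 x.val_ne_zero
  have hy0 : σ y.val ≠ 0 := (map_ne_zero σ).2 y.val_ne_zero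
  have hx1 : σ x.val ≠ 1 := fun h => x.val_ne_one (σ.injective (by rw [h, map_one]))
  have hy1 : σ y.val ≠ 1 := fun h => y.val_ne_one (σ.injective (by rw [h, map_one]))
  have hxy' : σ x.val ≠ σ y.val := fun h => hxy (σ.injective h)
  simp only [fiveTermRelator, map_add, map_sub, regulatorAt_of, Gen.val_quot, Gen.val_quotInv,
    Gen.val_quotSub, map_div₀, map_one, map_inv₀]
  exact blochWignerDilog_five_term_neumann hx0 hx1 hy0 hy1 hxy'

/-- The five-term relators lie in the kernel of every regulator component.
[cite: Neumann1998, Thm. 3.2] -/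
theorem closure_fiveTermRelators_le_ker_regulatorAt (σ : F →+* ℂ) :
    AddSubgroup.closure (fiveTermRelators F) ≤ (regulatorAt σ).ker :=
  (AddSubgroup.closure_le _).2 (by
    rintro r ⟨x, y, hxy, rfl⟩
    simp only [SetLike.mem_coe, AddMonoidHom.mem_ker]
    exact regulatorAt_fiveTermRelator σ x y hxy)

/-- Hence every regulator component vanishes on the subgroup generated by the five-term relators.
[cite: Neumann1998, Thm. 3.2] -/
theorem regulatorAt_eq_zero_of_mem_closure (σ : F →+* ℂ) {ξ : FreeAbelianGroup (Gen F)}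
    (hξ : ξ ∈ AddSubgroup.closure (fiveTermRelators F)) : regulatorAt σ ξ = 0 :=
  (AddMonoidHom.mem_ker).1 (closure_fiveTermRelators_le_ker_regulatorAt σ hξ)

/-- **The Borel regulator component on `P(F)`** at an embedding `σ : F → ℂ` — Neumann's map
"induced on generators of `P(k)` by `[z] ↦ vol[σ(z)]`", `vol[z] = D(z)`.
[cite: Neumann1998, Thm. 3.2] -/
def regulator (σ : F →+* ℂ) : PreBloch F →+ ℝ :=
  QuotientAddGroup.lift (AddSubgroup.closure (fiveTermRelators F)) (regulatorAt σ)
    (closure_fiveTermRelators_le_ker_regulatorAt σ)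

/-- The regulator component of the class of `ξ ∈ ℤ⟨F ∖ {0,1}⟩`. [cite: Neumann1998, Thm. 3.2] -/
@[simp] theorem regulator_proj (σ : F →+* ℂ) (ξ : FreeAbelianGroup (Gen F)) :
    regulator σ (proj ξ) = regulatorAt σ ξ :=
  rfl

/-- The regulator component of a generator: `[z] ↦ D(σ z)`. [cite: Neumann1998, Thm. 3.2] -/
theorem regulator_mk (σ : F →+* ℂ) (z : F) (hz : z ≠ 0 ∧ z ≠ 1) :
    regulator σ (PreBloch.mk z hz) = blochWignerDilog (σ z) :=
  regulatorAt_of σ ⟨z, hz⟩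

end PreBloch

/-- **The fact, on the pre-Bloch group.** Under `Borel1977_blochGroup_regulator_kernel_torsion`:
an element of `P(F)` (`F` a number field) killed by every Dehn pairing (i.e. rationally in the
Bloch group `B(F)`) and by every regulator component is torsion — the kernel statement of
Thm. 3.2 in Neumann's own terms. [cite: Neumann1998, Thm. 3.2] -/
theorem Borel1977_blochGroup_regulator_kernel_torsion.of_preBloch
    (h : Borel1977_blochGroup_regulator_kernel_torsion) {F : Type} [Field F] [NumberField F]
    (η : PreBloch F) (hδ : ∀ u v : Additive Fˣ →+ ℚ, PreBloch.dehnPairing u v η = 0)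
    (hρ : ∀ σ : F →+* ℂ, PreBloch.regulator σ η = 0) : ∃ N : ℕ, 0 < N ∧ N • η = 0 := by
  obtain ⟨ξ, rfl⟩ := PreBloch.proj_surjective η
  exact h F ξ (fun u v => by simpa using hδ u v) (fun σ => by simpa using hρ σ)

end Literature.NumberTheory.Transcendental

end
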